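import Mathlib
import HarnessLib

/-!
# Weil-type family coverage — LEMMA IO× : the fibre-product obstruction for PRODUCT windows (ring2-b06, gen 105)

research route conditional on HC_CM; not a corollary; Q11.4-sentence-2 already refuted in dim ≥ 3.

Ring 2, WEIL-TYPE FAMILY-COVERAGE CENSUS (`HOME/WEIL-FAMILY-COVERAGE.md`, column «×2 + tree-status», block b06.27, owner
ring2-b06).  A product window is a branch datum `((a₁, y₁), …, (a_N, y_N))` of the direct product `G₁ × G₂` of a carrier `G₁`
(`GL₂(3)`, `SD₁₆`, `SL₂(7)`, …) and a second factor `G₂`; the hidden factor of the census is defined on the CONNECTED cover, i.e.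
it needs the tuple to GENERATE `G₁ × G₂`.  Even when the `a_j` generate `G₁` and the `y_j` generate `G₂`, the pairs may generate
only a fibre product (Goursat): this file checks the index-`2` case in the kernel.

* §1 **LEMMA IO×.**  For homomorphisms `f₁ : G₁ → M`, `f₂ : G₂ → M` into a commutative group, the map
  `d(g₁, g₂) = f₁(g₁) · f₂(g₂)⁻¹` is a homomorphism; a set of pairs on which `f₁(a) = f₂(y)` generates a subgroup of `ker d`; and if
  `f₁` is non-trivial this subgroup is proper (`(g, 1) ∉ ker d`).  With `M = {±1}`, `f₁ = η` a sign character of the carrier and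
  `f₂ = ε` the outer sign of `G₂ = G.2`: a product tuple with `η(a_j) = ε(y_j)` for all `j` does NOT generate `G₁ × G₂`.
* §2 **the sign bookkeeping.**  In `(ℤ/2)³` the vectors of even weight other than `0` are exactly `(1,1,0)`, `(0,1,1)`, `(1,0,1)` —
  the signatures of the three sign characters of `SD₁₆` (kernels `C₈`, `D₈`, `Q₈`) on a product-one triple of orders `(2, 4, 8)`
  (such a triple is forced to be `(x^{2j}y, x^{a}y, x^{e})`, `a, e` odd); so an `SD₁₆`-`(2,4,8)` product triple whose `G₂`-side
  contains an outer class of `G.2` (hence exactly two) never generates `SD₁₆ × G.2`.  (Census: the 240 `SD₁₆ × 2.L2(13).2`, the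
  32 `SD₁₆ × 2.S6(3).2` and — with `GL₂(3)`'s determinant — the 20 `GL₂(3) × 3.O7(3).2` open-candidate records of ring2-b02's
  b02.26/27 are not windows of those groups; machine: `weilcov-g105/sweep_iox.py`, `t2_gen.py`.)
* §3 **the corrected object for the 16 `T(|Π|) = {2,13}` records.**  On the index-`2` fibre product `SD₁₆ ×_{C₂} 2.L2(13).2` the
  character `χ₂ ⊗ χ₁₆` restricts to a rational irreducible `π'` of Schur index `2` whose division algebra is Hamilton's `(-1,-1)_ℚ`
  (coset engine: the Hecke algebra on the hidden lattice is `(-52, -2704)_ℚ ≃ (-13, -1)_ℚ`); the census fields inside it are met by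
  explicit pure quaternions `J_d = x i + y j + z ij` (`i² = -13`, `j² = -1`) with `J_d² = -d·s²`: `d = 2: (1,0,-5)`, `d = 1: (0,-1,0)`,
  `d = 3: (1,-1,-1)`, `d = 11: (3,-13,-11)`, `d = 19: (3,-13,-15)`, `d = 43: (1,-7,-5)`, `d = 67: (5,-39,-27)`, `d = 163: (9,-13,-45)` —
  the identities checked in §3 (`ℚ(√-7)` does not embed: `2` splits there); `-1` is a square modulo `13` (so `13` does not ramify).

Nothing in this file is a statement about Hodge classes; `HC_CM` is used nowhere; no `def`, no named fact.
References: [cite: vanGeemen1994HodgeAV, 5.2]; Goursat's lemma [folklore].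
-/

noncomputable section

set_option linter.dupNamespace false

namespace Summit.HodgeConjecture.HodgeConjecture.Ring2.WeilCoverage

namespace FibreProductObstruction

/-! ### §1 LEMMA IO× — a product tuple with matching signs lies in an index-2 fibre product -/

/-- The «difference of signs» homomorphism `d(g₁, g₂) = f₁(g₁) · f₂(g₂)⁻¹` on `G₁ × G₂` (values in a commutative group).
research route conditional on HC_CM; not a corollary; Q11.4-sentence-2 already refuted in dim ≥ 3. [folklore] -/
theorem signDiff_apply {G₁ G₂ M : Type*} [Group G₁] [Group G₂] [CommGroup M] (f₁ : G₁ →* M) (f₂ : G₂ →* M)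
    (p : G₁ × G₂) :
    ((f₁.comp (MonoidHom.fst G₁ G₂)) * (f₂.comp (MonoidHom.snd G₁ G₂))⁻¹) p = f₁ p.1 * (f₂ p.2)⁻¹ := by
  simp

/-- **LEMMA IO× (i).**  If `f₁(a) = f₂(y)` for every pair `(a, y)` of a set `S ⊆ G₁ × G₂`, the subgroup generated by `S` lies in
the kernel of `d = f₁ · f₂⁻¹` (a fibre product `G₁ ×_M G₂`).
research route conditional on HC_CM; not a corollary; Q11.4-sentence-2 already refuted in dim ≥ 3. [folklore] -/
theorem closure_le_ker_signDiff {G₁ G₂ M : Type*} [Group G₁] [Group G₂] [CommGroup M] (f₁ : G₁ →* M) (f₂ : G₂ →* M)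
    (S : Set (G₁ × G₂)) (hS : ∀ s ∈ S, f₁ s.1 = f₂ s.2) :
    Subgroup.closure S ≤ ((f₁.comp (MonoidHom.fst G₁ G₂)) * (f₂.comp (MonoidHom.snd G₁ G₂))⁻¹).ker := by
  rw [Subgroup.closure_le]
  intro s hs
  rw [SetLike.mem_coe, MonoidHom.mem_ker, signDiff_apply, hS s hs, mul_inv_cancel]

/-- **LEMMA IO× (ii).**  If moreover `f₁` is non-trivial, the subgroup generated by `S` is PROPER: the element `(g, 1)` with
`f₁(g) ≠ 1` is not in the kernel of `d`.  (Census reading: `f₁ = η` a sign character of the carrier `SD₁₆` / `GL₂(3)`, `f₂ = ε` the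
outer sign of `G₂ = G.2`; a product branch tuple with `η(a_j) = ε(y_j)` for all `j` is not a connected `G₁ × G₂`-window.)
research route conditional on HC_CM; not a corollary; Q11.4-sentence-2 already refuted in dim ≥ 3. [folklore] -/
theorem closure_ne_top_of_signs_agree {G₁ G₂ M : Type*} [Group G₁] [Group G₂] [CommGroup M] (f₁ : G₁ →* M)
    (f₂ : G₂ →* M) (S : Set (G₁ × G₂)) (hS : ∀ s ∈ S, f₁ s.1 = f₂ s.2) (hf : ∃ g : G₁, f₁ g ≠ 1) :
    Subgroup.closure S ≠ ⊤ := by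
  obtain ⟨g, hg⟩ := hf
  intro htop
  have hmem : ((g, 1) : G₁ × G₂) ∈ Subgroup.closure S := by rw [htop]; exact Subgroup.mem_top _
  have hker := closure_le_ker_signDiff f₁ f₂ S hS hmem
  rw [MonoidHom.mem_ker, signDiff_apply] at hker
  simp only [map_one, inv_one, mul_one] at hker
  exact hg hker

/-- **LEMMA IO× (iii), the central-product variant.**  The same kernel contains every element `(c₁, c₂)` with `f₁(c₁) = f₂(c₂)`
— in particular a diagonal central involution `(z₁, z₂)` with `f₁(z₁) = f₂(z₂) = 1` — so passing to `(G₁ × G₂)/⟨(z₁,z₂)⟩`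
(ring2-b02's «ztwist») does not restore generation: the image of the tuple still lies in a subgroup of index `2`.
Formally: the subgroup generated by `S ∪ {c}` is still inside the kernel.
research route conditional on HC_CM; not a corollary; Q11.4-sentence-2 already refuted in dim ≥ 3. [folklore] -/
theorem closure_insert_le_ker_signDiff {G₁ G₂ M : Type*} [Group G₁] [Group G₂] [CommGroup M] (f₁ : G₁ →* M)
    (f₂ : G₂ →* M) (S : Set (G₁ × G₂)) (hS : ∀ s ∈ S, f₁ s.1 = f₂ s.2) (c : G₁ × G₂) (hc : f₁ c.1 = f₂ c.2) :
    Subgroup.closure (insert c S) ≤ ((f₁.comp (MonoidHom.fst G₁ G₂)) * (f₂.comp (MonoidHom.snd G₁ G₂))⁻¹).ker := by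
  apply closure_le_ker_signDiff
  intro s hs
  rcases Set.mem_insert_iff.1 hs with h | h
  · rw [h]; exact hc
  · exact hS s h

/-! ### §2 the sign bookkeeping in `(ℤ/2)³` -/

/-- **The three `SD₁₆` signatures exhaust the even non-zero vectors of `(ℤ/2)³`.**  A product-one triple of `G.2` has an even
number of outer classes; if it has one at all, its outer-signature is `(1,1,0)`, `(0,1,1)` or `(1,0,1)` — the signatures, on an
`SD₁₆`-triple `(x^{2j}y, x^{a}y, x^{e})` (`a, e` odd) of orders `(2,4,8)`, of the sign characters with kernels `C₈ = ⟨x⟩`,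
`D₈ = ⟨x², y⟩`, `Q₈ = ⟨x², xy⟩` respectively.  Hence LEMMA IO× applies to every such triple.
research route conditional on HC_CM; not a corollary; Q11.4-sentence-2 already refuted in dim ≥ 3. [folklore] -/
theorem even_nonzero_vectors_zmod2 (v : ZMod 2 × ZMod 2 × ZMod 2) (hsum : v.1 + v.2.1 + v.2.2 = 0) (hne : v ≠ (0, 0, 0)) :
    v = (1, 1, 0) ∨ v = (0, 1, 1) ∨ v = (1, 0, 1) := by
  revert v
  decide

/-- **The `SD₁₆` side is forced.**  In terms of the exponents: a triple `x^{b₁}y^{e₁} · x^{b₂}y^{e₂} · x^{b₃}y^{e₃}` of `SD₁₆`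
with `y`-parities `(e₁, e₂, e₃) = (1, 1, 0)` (involution outside `⟨x⟩`, order-`4` element outside `⟨x⟩`, order-`8` element inside)
has sign values `η_{C₈} = (e₁,e₂,e₃) = (1,1,0)`, `η_{D₈} = (b₁,b₂,b₃) mod 2 = (0,1,1)` (even, odd, odd) and `η_{Q₈} = (bⱼ + eⱼ) =
(1,0,1)`; the three together with `0` form the subgroup of even vectors: any even vector `w ≠ 0` equals one of them
(`even_nonzero_vectors_zmod2`).  This lemma records the three signature vectors are pairwise distinct and each has weight two.
research route conditional on HC_CM; not a corollary; Q11.4-sentence-2 already refuted in dim ≥ 3. [folklore] -/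
theorem sd16_signatures_distinct :
    ((1, 1, 0) : ZMod 2 × ZMod 2 × ZMod 2) ≠ (0, 1, 1) ∧ ((0, 1, 1) : ZMod 2 × ZMod 2 × ZMod 2) ≠ (1, 0, 1) ∧
      ((1, 1, 0) : ZMod 2 × ZMod 2 × ZMod 2) ≠ (1, 0, 1) := by
  decide

/-- **The orders of the fibre products of the census records.** `|SD₁₆ × 2.L2(13).2| = 16 · 4368 = 69888`, the fibre product has
order `34944`, its quotient by the diagonal central involution `17472`; the Riemann–Hurwitz genera of a three-point cover with
local orders `(26, 4, 8)` are `20497` (for a group of order `69888`, ring2-b02's record) and `10249` (order `34944`, the connected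
cover), and with local orders `(26, 2, 4)` (the central quotient) `3697` resp. `1849`:
`2g - 2 = |G|·(1 - 1/26 - 1/4 - 1/8)` etc.
research route conditional on HC_CM; not a corollary; Q11.4-sentence-2 already refuted in dim ≥ 3. [folklore] -/
theorem fibre_product_orders_and_genera :
    16 * 4368 = 69888 ∧ 69888 / 2 = 34944 ∧ 34944 / 2 = 17472 ∧
      (2 * 20497 - 2 : ℚ) = 69888 * (1 - 1 / 26 - 1 / 4 - 1 / 8) ∧
      (2 * 10249 - 2 : ℚ) = 34944 * (1 - 1 / 26 - 1 / 4 - 1 / 8) ∧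
      (2 * 3697 - 2 : ℚ) = 34944 * (1 - 1 / 26 - 1 / 2 - 1 / 4) ∧
      (2 * 1849 - 2 : ℚ) = 17472 * (1 - 1 / 26 - 1 / 2 - 1 / 4) := by
  norm_num

/-! ### §3 the quaternion algebra of the corrected object -/

/-- **`ℚ(√-2)` inside the Hecke quaternion algebra of the (c2) records.**  On the hidden lattice of the connected
`SD₁₆ ×_{C₂} 2.L2(13).2`-cover `(0; 2:13a, 4b:4b, 8a:8a)` the Hecke algebra is generated by `i₀`, `j₀` with `i₀² = -52`,
`j₀² = -2704`, `i₀j₀ = -j₀i₀` (first run) — square classes `-52 = -13·2²`, `-2704 = -1·52²`, so after rescaling `i² = -13`, `j² = -1`,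
`(ij)² = -13`; the pure quaternion `J = i - 5 ij` has `J² = -13·1² - 1·0² - 13·5² = -338 = -2·13²`, so `J/13` is a square root of `-2`:
the census field `K = ℚ(√-2)` embeds (coset engine, `weilcov-g105/l213win.py`, 13/13 runs).
research route conditional on HC_CM; not a corollary; Q11.4-sentence-2 already refuted in dim ≥ 3. [folklore] -/
theorem sqrtNeg2_in_hecke_quaternion :
    (-52 : ℤ) = -13 * 2 ^ 2 ∧ (-2704 : ℤ) = -1 * 52 ^ 2 ∧
      (-13 : ℤ) * 1 ^ 2 + (-1) * 0 ^ 2 + (-13) * 5 ^ 2 = -2 * 13 ^ 2 := by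
  norm_num

/-- **Every census field with `2` non-split embeds: the pure quaternions `J_d`.**  With `i² = -13`, `j² = -1`, `(ij)² = -13` and
`J = x i + y j + z ij`, `J² = -13x² - y² - 13z²`; the coset engine's representatives:
`d = 1: (0,-1,0)`, `d = 3: (1,-1,-1)` (`-27 = -3·3²`), `d = 11: (3,-13,-11)` (`-1859 = -11·13²`), `d = 19: (3,-13,-15)` (`-3211 = -19·13²`),
`d = 43: (1,-7,-5)` (`-387 = -43·3²`), `d = 67: (5,-39,-27)` (`-11323 = -67·13²`), `d = 163: (9,-13,-45)` (`-27547 = -163·13²`).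
(`d = 7` has no representative: `x² + y² + z²`-type obstruction at `2`, i.e. `2` splits in `ℚ(√-7)`.)
research route conditional on HC_CM; not a corollary; Q11.4-sentence-2 already refuted in dim ≥ 3. [folklore] -/
theorem census_fields_in_hamilton_quaternions :
    (-13 : ℤ) * 0 ^ 2 - 1 ^ 2 - 13 * 0 ^ 2 = -1 * 1 ^ 2 ∧
      (-13 : ℤ) * 1 ^ 2 - 1 ^ 2 - 13 * 1 ^ 2 = -3 * 3 ^ 2 ∧
      (-13 : ℤ) * 3 ^ 2 - 13 ^ 2 - 13 * 11 ^ 2 = -11 * 13 ^ 2 ∧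
      (-13 : ℤ) * 3 ^ 2 - 13 ^ 2 - 13 * 15 ^ 2 = -19 * 13 ^ 2 ∧
      (-13 : ℤ) * 1 ^ 2 - 7 ^ 2 - 13 * 5 ^ 2 = -43 * 3 ^ 2 ∧
      (-13 : ℤ) * 5 ^ 2 - 39 ^ 2 - 13 * 27 ^ 2 = -67 * 13 ^ 2 ∧
      (-13 : ℤ) * 9 ^ 2 - 13 ^ 2 - 13 * 45 ^ 2 = -163 * 13 ^ 2 := by
  norm_num

/-- **The Hecke quaternion algebra is Hamilton's: `(-52, -2704)_ℚ ≃ (-13, -1)_ℚ ≃ (-1, -1)_ℚ`.**  `-1` is a square modulo `13`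
(`5² ≡ -1`), so the Hilbert symbol `(-13, -1)₁₃ = +1` and `13` does not ramify: the finite ramification is `{2}` (the algebra is
definite and the number of ramified places is even).  This is NOT ring2-b02's `𝔻(χ₁₆) = (-2, -13)_ℚ` (ramified at `13`): `-2` is a
non-square modulo `13`.  `ℚ(√-7)` does not embed: `-7 ≡ 1 (mod 8)`, i.e. `2` splits in `ℚ(√-7)`, witnessed by `-7 = 1 - 8`.
research route conditional on HC_CM; not a corollary; Q11.4-sentence-2 already refuted in dim ≥ 3. [folklore] -/
theorem hecke_quaternion_square_classes :
    (5 : ZMod 13) ^ 2 = -1 ∧ ¬ IsSquare (-2 : ZMod 13) ∧ (-7 : ZMod 8) = 1 := by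
  refine ⟨by decide, by decide, by decide⟩

/-- **Rows of the corrected object: the valuations of the hidden discriminants.**  The coset engine's `det_K H` on the hidden
sixfold of `(0; 2:13a, 4b:4b, 8a:8a)` is `-2¹²·3²·7⁶·13⁵` for `K = ℚ(√-2)` (`T = {2,13}`, row `W6.2.13`), `-2¹¹·7⁶·13²` for `ℚ(i)`
(`T = ∅`, split), `-2¹⁵·3²·7⁷·13²` for `ℚ(√-3)` (`T = {2,3}`, row `W6.3.2 = R1`), `-2¹⁵·3⁵·5·7⁶·13⁵` for `ℚ(√-11)` (`T = {2,13}`,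
`W6.11.26`).  The residue facts deciding the odd inert primes: `-2` is a non-square mod `13` and mod `7` (inert; `v₁₃ = 5` odd,
`v₇ = 6` even) and a square mod `3` (split); `-3` is a non-square mod `7`?  No — `-3 ≡ 4 = 2²` mod `7`: `7` SPLITS in `ℚ(√-3)`, so
`7⁷` does not enter `T`; `-3` is a square mod `13` (`13 ≡ 1 mod 3`); `-11` is a non-square mod `13` (inert, `v₁₃ = 5` odd) and a square
mod `3`, `5` (`-11 ≡ 1`, `-11 ≡ 4`); `-1` is a square mod `13` (split).
research route conditional on HC_CM; not a corollary; Q11.4-sentence-2 already refuted in dim ≥ 3. [folklore] -/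
theorem rows_residue_facts :
    ¬ IsSquare (-2 : ZMod 13) ∧ ¬ IsSquare (-2 : ZMod 7) ∧ IsSquare (-2 : ZMod 3) ∧
      IsSquare (-3 : ZMod 7) ∧ IsSquare (-3 : ZMod 13) ∧
      ¬ IsSquare (-11 : ZMod 13) ∧ IsSquare (-11 : ZMod 3) ∧ IsSquare (-11 : ZMod 5) ∧
      IsSquare (-1 : ZMod 13) := by
  refine ⟨by decide, by decide, ⟨1, by decide⟩, ⟨2, by decide⟩, ⟨6, by decide⟩, by decide, ⟨1, by decide⟩, ⟨2, by decide⟩,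
    ⟨5, by decide⟩⟩

end FibreProductObstruction

end Summit.HodgeConjecture.HodgeConjecture.Ring2.WeilCoverage

end
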